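import Literature.MathematicalPhysics.QuantumFieldTheory.Balaban1983to89.B8Thm2TorusKnitCubeGeometry
import Literature.MathematicalPhysics.QuantumFieldTheory.Balaban1983to89.B9BetaRangeKLevelV1
import Literature.MathematicalPhysics.QuantumFieldTheory.Balaban1983to89.B9PinMembersKLevelV1
import Literature.MathematicalPhysics.QuantumFieldTheory.Balaban1983to89.Node00.OpsYSectELetters

/-!
# `Balaban1983to89.B8Thm2TorusMemberCatalogue` — M5.9 ASSEMBLY, FILE A11: THE MEMBER CATALOGUE OF THE G-B8-T2S ENDPOINT, CONSTRUCTED — for every torus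
# `T_η` of period `2L^T` and every level `n` with `n + k₀ ≤ T`, an explicit member of the k-level V1 family ([Balaban1984PropagatorsII] (2.1)–(2.4): the
# nested torus family) with ONE EMPTY TOP LEVEL (`Ω₁ = … = Ω_n = T_η`, `Ω_{n+1} = ∅`: nominal index `n + 1`, constant level `n`), big blocks `M = L^{a+1}`
# above any prescribed threshold, print's units `c_f = L^{n+1}`, and its carrier-block map `β` ONTO (so a section `ιB` exists) — and the endpoint of file A10
# re-issued with the catalogue DISCHARGED: `∃ k₀, mem, ιB, B₁ B₂ c₁ > 0` such that for every `m K k η` with `k + k₀ ≤ m + K`: analytic cube data at the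
# catalogued members → (B)-lines → `Thm2SetupSUAt (PV d ℓ m K) N k η 0 B₁ B₂ c₁ len ⊤`

statement-level skeleton of published theorems with citation tags; proofs where landed; nothing here is a claim about the
Yang–Mills mass gap

T. Bałaban, *Propagators and renormalization transformations for lattice gauge theories. II*, Commun. Math. Phys. **96** (1984) 223–250 [`Balaban1984PropagatorsII`,
"[4]"]: (2.1)–(2.4) p. 224 (*«we admit the case when some domains Ω_j are equal to T_η»*; the sequence of domains, big blocks of the size `ML^jη`), (2.16) p. 225,
(2.45) p. 231, p. 229 (*«cubes □ of the size 2ML^jη»*), Lemma 2.1 p. 234 (*«for RM satisfying (2.59)»*).  T. Bałaban, *Propagators for lattice gauge theories in a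
background field*, Commun. Math. Phys. **99** (1985) 389–434 [`Balaban1985BackgroundPropagators`, "[B9]"]: p. 399 (the family), Thm 3.1 p. 397 (*«for M ≥ M₁»*),
Thm 3.9 p. 413 (*«For M sufficiently large»*).  T. Bałaban, *Spaces of regular gauge field configurations on a lattice and gauge fixing conditions*, Commun. Math.
Phys. **99** (1985) 75–102 [`Balaban1985RegularSpaces`, "[B8]"]: Thm 2 p. 83, (1.33)–(1.39) pp. 82–83, p. 77 (*«Ω_j = T_η for j = 0,1,…,l, l ≤ k»*).
T. Bałaban, *Averaging operations for lattice gauge theories*, Commun. Math. Phys. **98** (1985) 17–51 [`Balaban1985Averaging`]: (4) p. 18.  STATUS: published, refereed.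

WHY THIS FILE ∕ THE ARGUMENT.  Files A5–A10 display a CATALOGUE `memF` of def-Y members: for the k-level run of [B8] Thm 2 on the torus of period `P₀ = 2L^{m+K}`,
one member per level `n ≤ k`, of constant level `n`, nominal index `≤ n + e_s`, `c_f = Lᵏ`, with a section `ιB` of its carrier-block map and, since file A10,
big blocks above the geometry threshold `M_L`.  The V1 lineage has every ingredient: `B6KLevelFamilyWitnessOddLV1.exists_const_TDomains` (a constant level
function is a domain sequence (2.1)–(2.2)), `B6KLevelFamilyWitnessV1.N0_V1_pow` (the period arithmetic `L^k·L·L^a·2L^s = 2L^T`), `globalBand_witness` ((2.16)),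
`exists_exponent` (`M = L^{a+1}` beyond any threshold), `B6CubeWindowV1.placed_of_lt` (cubes BELOW the top level are placed at EVERY odd `L ≥ 5` — whence the
design with one EMPTY top level, nominal index `n + 1`: all cubes are of level `n < n + 1`; this also serves `n = 1` under `KIdx.hk2 : 2 ≤ k`), and r06∕def-Y's
`B9BetaRangeKLevelV1.surjective_beta_iff` (with `Ω_{n+1} = ∅` nothing is deep, so `β` is onto `𝔅` and `Function.surjInv` is a section).  The price is print's own:
the torus must contain `2L^s ≥ 2L` big top blocks per direction, `P₀ = 2L^T` with `T = n + a + 2 + s` — a VOLUME THRESHOLD `n + k₀ ≤ T`, `k₀ = a + 3`.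

CITATION HEADER (lean-in-tree rule).  Cell `lit-balaban`, seat `lit-balaban-t2s-1` (gen 5), MODULE M5.9, file A11; sub-row G-B8-T2S (R3 `stmt-QuantumFields-19200`,
helper).  REUSED BY NAME: the V1 witnesses listed, `B9PinMembersKLevelV1.kIdx_topConst_L5`'s construction pattern (r03∕p21 lineage), `B6GlobalChartV1.iterBlockOf_mem_domT_iff`,
`Node00.iterBlockOf_embIter`, file A10 `exists_threshold_knitCubeGeometry`, `KnitCubeInputs.ofGeometry`, `KnitCubeAnalytic`, file A9 `thm2SetupSUAt_ofCubes_exists`.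

WHAT THIS FILE PROVES (sorry-free; no definitions; nothing of [B8]∕[B9]'s estimates asserted).
* §1 `not_deep_of_constLev`, ★ `surjective_beta_of_constLev` (one empty top level ⇒ `β` onto `𝔅`), ★★ **`exists_constLev_member`** — for `4 ≤ ℓ`, band
  `0 < b₀ ≤ b₁`, `1 ≤ n`, `8 ≤ L^a`, `1 ≤ s`, `T = n + a + 2 + s`: a member `i` with `i.m = T`, `i.K = 0`, `i.k = n + 1`, `i.Mh = L^a`, `c_f = L^{i.k}`, `lev ≡ n`,
  `β` onto.
* §2 ★★ **`exists_catalogue`** — for every threshold `M_L`: `∃ k₀ (mem : ℤ → ℕ → KIdx) (ιBm)`, such that for all `m K n` with `1 ≤ n`, `n + k₀ ≤ m + K`, the member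
  `mem P₀ n` (`P₀ = sitesPerDir 0` of `PV d ℓ m K`) has `m`-field `m + K`, `K`-field `0`, nominal index `n + 1`, `c_f = L^{n+1}`, constant level `n`,
  `M_L ≤ M`, and `ιBm P₀ n` is a section of its `β`.
* §3 ★★★★★★★ **`thm2SetupSUAt_catalogued_exists`** — for `1 ≤ N ≤ 25`, `d + 1 ≥ 2`, `4 ≤ ℓ`, band `0 < b₀ ≤ b₁`, the (B)-line constants, `c_L > 0` with
  `c_L·L² < α₀′`, cube scalars `p` (`p.Valid`, `KnitCubeGeoValid`): `∃ k₀ mem ιBm B₁ B₂ c₁`, `0 < B₁ ∧ 0 < B₂ ∧ 0 < c₁`, the catalogue spec of §2, and for every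
  `m K k η` (`1 ≤ k`, `k + k₀ ≤ m + K`, `η > 0`): analytic cube data `KnitCubeAnalytic` at the members `mem P₀ n`, `n ≤ k`, and every `SU(N)`-valued `P₀`-periodic
  `U₀ ∈ 𝔄_n(T_η, α₀)`, `α₀ ≤ c_L` (unit `s = η_S⁻⁴`) → (B)-lines → `Thm2SetupSUAt (PV d ℓ m K hd hL) N k η 0 B₁ B₂ c₁ len (fun _ => True)`.

HONEST SCOPE.  The catalogue is CONSTRUCTED (no catalogue hypothesis remains); LOCATED VOLUME THRESHOLD: the conclusion is offered for `k + k₀ ≤ m + K` only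
(`k₀ = a + 3` with `L^{a+1}` above file A10's geometry threshold and `L^a ≥ 8`) — print's «M sufficiently large» read on a torus that must contain the big blocks;
for the R3 consumer (`k ≤ K`) this is a lower bound `m ≥ k₀` on the volume exponent, NOT implied by `T3Family.hm : 1 ≤ m`.  The analytic cube data (M5.1–M5.6's
output shapes; `hD` = GAP G-B9-05) and the (B)-lines (M5.7–M5.8) remain DISPLAYED, inhabited by nothing here; count-neutral; N05 ∕ `stub_PV3A` NOT discharged;
nothing continuum ∕ ℝ⁴ ∕ OS ∕ mass-gap ∕ Clay — the Yang–Mills mass gap is NOT proved.  No `sorry`, no `axiom`, no `… : Prop` fact, no `instance`, no `notation`.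
NEW file; nothing landed is modified.  Seat `lit-balaban-t2s-1` gen 5, 2026-08-28.
-/

noncomputable section

open scoped BigOperators

namespace Literature.MathematicalPhysics.QuantumFieldTheory.Balaban1983to89.B8Thm2TorusMemberCatalogue

open Node00 B6KLevelCensusIndexV1 B9Eq39Adjoint
open B7Prop1Explicit renaming Site → LSite
open B7Prop1Explicit (e)
open B5Eq118OneStroke (iterBlockOf)
open B15DeterminingSets (embIter)
open B6MultiLevelBoxOperator (N0)
open B6MultiLevelTorusOperator (TDomains)
open B6SectAOperatorsV1 (BondIdx)
open B6CubeWindowV1 (Placed GlobalBand placed_of_lt)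
open B6Cover236MultiLevelBlocks (cubes)
open B6GlobalChartV1 (PV toBox domT iterBlockOf_mem_domT_iff)
open B6KLevelFamilyWitnessOddLV1 (exists_const_TDomains)
open B6KLevelFamilyWitnessV1 (N0_V1_pow globalBand_witness exists_exponent)
open B6Ineq2142KLevelV1 (β)
open B9BetaRangeKLevelV1 (surjective_beta_iff)
open B9GeoNormsKLevelV1 (geo9K)
open B9Ineq349SiteComposite (etaS_pos)
open B8Ineq132 (InAk)
open B8Thm2TorusLettersPerOfKnit (bgY)
open B8Thm2TorusKnitEstimatesOfMajorants (B9P3PerAt)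
open B8Thm2TorusKnitMajorantsOfCubes (KnitCubeParams KnitCubeInputs)
open B8Thm2SetupTorusOfCubes (thm2SetupSUAt_ofCubes_exists)
open B8Thm2TorusKnitCubeGeometry (KnitCubeGeoValid KnitCubeAnalytic KnitCubeInputs.ofGeometry exists_threshold_knitCubeGeometry)
open B7Prop2SpecialUnitary (specialUnitaryUnits)
open B8Thm2SetupTorus (Thm2SetupSUAt)
open scoped Matrix Matrix.Norms.L2Operator

variable {d ℓ : ℕ} {hd : 1 ≤ d + 1} {hL : Odd (ℓ + 1) ∧ 1 < ℓ + 1} {b₀ b₁ : ℝ}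

/-! ## §1 One member with an empty top level: constant level `n`, nominal index `n + 1`, `β` onto -/

section Member

variable {T Mh R n : ℕ} {P' : Fin (d + 1) → ℕ}

/-- **WITH AN EMPTY TOP LEVEL NOTHING IS DEEP**: for a domain sequence of constant level `n` and nominal index `n + 1` (`Ω_{n+1} = ∅`), no block of level `n` is
deep (its `(n+1)`-block is not in `Ω_{n+1}^{(n+1)}`). [cite: Balaban1984PropagatorsII, (2.3)–(2.4) p.224, dictionary (charts)] -/
theorem not_deep_of_constLev (hN : ∀ μ, N0 ℓ Mh (n + 1) P' μ = (PV d ℓ T 0 hd hL).sitesPerDir 0) (D : TDomains d ℓ Mh (n + 1) P' R)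
    (hk : n + 1 ≤ T + 0) (hD : ∀ x, D.lev x = n) {j : ℕ} (hj : j = n) (y : Site (PV d ℓ T 0 hd hL) j) :
    ¬ (domT hN D hk).Deep j y := by
  subst hj
  intro hdeep
  have hmem := hdeep
  unfold B6SectADomainsV1.Domains.Deep at hmem
  -- a fine site whose `(n+1)`-block is the `(n+1)`-block of `y`
  have hx' := Node00.iterBlockOf_embIter (P := PV d ℓ T 0 hd hL) _ (by exact hk) (blockOf y)
  rw [← hx'] at hmem
  have h := (iterBlockOf_mem_domT_iff hN D hk (by omega) le_rfl _).1 hmem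
  rw [hD] at h
  omega

/-- ★ **ONE EMPTY TOP LEVEL ⇒ THE CARRIER-BLOCK MAP `β` IS ONTO `𝔅`** (every block has a non-deep forward neighbour, `surjective_beta_iff`); hence
`Function.surjInv` is a section `ιB`. [cite: Balaban1984PropagatorsII, (2.3) p.224, (2.45) p.231] -/
theorem surjective_beta_of_constLev (hN : ∀ μ, N0 ℓ Mh (n + 1) P' μ = (PV d ℓ T 0 hd hL).sitesPerDir 0) (D : TDomains d ℓ Mh (n + 1) P' R)
    (hk : n + 1 ≤ T + 0) (hD : ∀ x, D.lev x = n) : Function.Surjective (β hN D hk) :=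
  (surjective_beta_iff hN D hk (by omega)).2 fun x0 => Or.inl ⟨0, not_deep_of_constLev hN D hk hD (hD _) _⟩

/-- ★★ **A MEMBER OF THE k-LEVEL V1 FAMILY WITH ONE EMPTY TOP LEVEL, ON THE TORUS OF PERIOD `2L^T`**: for odd `L ≥ 5`, band `0 < b₀ ≤ b₁`, a level `n ≥ 1`, a
big-block exponent `a` with `L^a ≥ 8`, `s ≥ 1` and `T = n + a + 2 + s`: a member `i` with `i.m = T`, `i.K = 0`, nominal index `i.k = n + 1`, `M_h = L^a`
(`M = L^{a+1}`), `P′ = 2L^s`, `R = 2L²`, print's units `c_f = L^{n+1}`, CONSTANT LEVEL `n`, and `β` onto `𝔅` (every cube is below the top level, hence placed,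
`placed_of_lt` — any `L`).  Construction pattern of `B9PinMembersKLevelV1.kIdx_topConst_L5`.
[cite: Balaban1984PropagatorsII, (2.1)–(2.4) p.224, (2.16) p.225, p.229, (2.45) p.231; Balaban1985BackgroundPropagators, p.399 (the family)] -/
theorem exists_constLev_member (hℓ : 4 ≤ ℓ) (hb₀ : 0 < b₀) (hb₁ : b₀ ≤ b₁) {T n a s : ℕ} (hn : 1 ≤ n) (h8 : 8 ≤ (ℓ + 1) ^ a) (hs : 1 ≤ s)
    (hT : T = (n + 1) + a + 1 + s) :
    ∃ i : KIdx d ℓ hd hL b₀ b₁, i.m = T ∧ i.K = 0 ∧ i.k = n + 1 ∧ i.Mh = (ℓ + 1) ^ a ∧ i.cf = (((ℓ + 1 : ℕ) : ℝ)) ^ i.k ∧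
      (∀ x, i.D.lev x = n) ∧ Function.Surjective (β i.hN i.D i.hk) := by
  set P' : Fin (d + 1) → ℕ := fun _ => 2 * (ℓ + 1) ^ s with hP'
  have hLs : ℓ + 1 ≤ (ℓ + 1) ^ s := by
    calc ℓ + 1 = (ℓ + 1) ^ 1 := (pow_one _).symm
      _ ≤ (ℓ + 1) ^ s := Nat.pow_le_pow_right (Nat.succ_pos ℓ) hs
  have hP5 : ∀ μ : Fin (d + 1), 5 ≤ P' μ := fun μ => by simp only [hP']; omega
  have hN : ∀ μ, N0 ℓ ((ℓ + 1) ^ a) (n + 1) P' μ = (PV d ℓ T 0 hd hL).sitesPerDir 0 :=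
    fun μ => N0_V1_pow ℓ (n + 1) a s T 0 hd hL (by omega) μ
  have hk' : n + 1 ≤ T + 0 := by omega
  obtain ⟨D, hD⟩ := exists_const_TDomains d ℓ ((ℓ + 1) ^ a) (n + 1) P' (2 * (ℓ + 1) ^ 2) (j := n) hn (Nat.le_succ n)
  have hpl : ∀ c : ↥(cubes D.toDomains), Placed ℓ (n + 1) P' c.1 := by
    intro c
    obtain ⟨x, _, hx⟩ := Finset.mem_image.1 c.2
    refine placed_of_lt hP5 c.1 ?_
    have h1 : c.1.1 = D.lev x := (congrArg Prod.fst hx).symm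
    rw [h1, hD x]
    exact Nat.lt_succ_self n
  obtain ⟨w, hw, hwb⟩ := globalBand_witness (domT hN D hk') hb₀ hb₁
  set cf : ℝ := (((ℓ + 1 : ℕ) : ℝ)) ^ (n + 1) with hcfdef
  have hcf : cf ≠ 0 := by positivity
  have hwb' : GlobalBand b₀ b₁ cf (fun i => cf ^ 2 * w i) := by
    intro i
    obtain ⟨h1, h2⟩ := hwb i
    have key : cf ^ 2 * w i / (cf / (((ℓ + 1 : ℕ) : ℝ)) ^ (i.1.1 : ℕ)) ^ 2 = w i / (1 / (((ℓ + 1 : ℕ) : ℝ)) ^ (i.1.1 : ℕ)) ^ 2 := by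
      field_simp
    dsimp only
    rw [key]
    exact ⟨h1, h2⟩
  refine ⟨⟨T, 0, (ℓ + 1) ^ a, n + 1, 2 * (ℓ + 1) ^ 2, a, P', hN, D, hk', by omega, rfl, h8, le_rfl, hP5, hℓ, hpl,
    cf, hcf, fun i => cf ^ 2 * w i, fun i => mul_pos (by positivity) (hw i), hwb'⟩,
    rfl, rfl, rfl, rfl, rfl, hD, surjective_beta_of_constLev hN D hk' hD⟩

end Member

/-! ## §2 The catalogue: one member per period `2L^T` and level `n` with `n + k₀ ≤ T`, above a prescribed `M`-threshold -/

section Catalogue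

/-- the period of the Setup torus is `2L^{m+K}`, as an integer. [cite: Balaban1985Averaging, (4) p.18, bookkeeping] -/
theorem period_eq (m K : ℕ) : (((PV d ℓ m K hd hL).sitesPerDir 0 : ℕ) : ℤ) = ((2 * (ℓ + 1) ^ (m + K) : ℕ) : ℤ) := by
  simp [Params.sitesPerDir]

/-- the total exponent is determined by the period: `2L^T = 2L^{T′} ⇒ T = T′`. [cite: Balaban1985Averaging, (4) p.18, bookkeeping] -/
theorem exponent_eq_of_period_eq (hℓ : 1 ≤ ℓ) {T T' : ℕ} (h : ((2 * (ℓ + 1) ^ T : ℕ) : ℤ) = ((2 * (ℓ + 1) ^ T' : ℕ) : ℤ)) : T = T' := by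
  have h1 : 2 * (ℓ + 1) ^ T = 2 * (ℓ + 1) ^ T' := by exact_mod_cast h
  have h2 : (ℓ + 1) ^ T = (ℓ + 1) ^ T' := by omega
  exact Nat.pow_right_injective (by omega : 2 ≤ ℓ + 1) h2

/-- ★★ **THE CATALOGUE** (by choice, from §1): for odd `L ≥ 5`, band `0 < b₀ ≤ b₁` and ANY threshold `M_L` there are `k₀`, members `mem P n` and sections
`ιBm P n` such that for every Setup torus `PV d ℓ m K` (period `P₀ = 2L^{m+K}`) and level `1 ≤ n` with `n + k₀ ≤ m + K`: `mem P₀ n` lives on the torus of period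
`P₀` (`m`-field `m + K`, `K`-field `0`), has nominal index `n + 1`, `c_f = L^{n+1}`, constant level `n`, big blocks above `M_L`, and `ιBm P₀ n` is a section of
its `β`.  (`k₀ = a + 3` with `L^a ≥ 8`, `M_L ≤ L^{a+1}`: `exists_exponent`.)
[cite: Balaban1984PropagatorsII, (2.1)–(2.4) p.224, Lemma 2.1 p.234 («for RM satisfying (2.59)»); Balaban1985BackgroundPropagators, Thm 3.1 p.397 («for M ≥ M₁»), Thm 3.9 p.413] -/
theorem exists_catalogue (hℓ : 4 ≤ ℓ) (hb₀ : 0 < b₀) (hb₁ : b₀ ≤ b₁) (ML : ℝ) :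
    ∃ (k₀ : ℕ) (mem : ℤ → ℕ → KIdx d ℓ hd hL b₀ b₁) (ιBm : ∀ P n, BlkY (mem P n) → IBondY (mem P n)),
      ∀ (m K n : ℕ), 1 ≤ n → n + k₀ ≤ m + K →
        (mem (((PV d ℓ m K hd hL).sitesPerDir 0 : ℕ) : ℤ) n).m = m + K ∧ (mem (((PV d ℓ m K hd hL).sitesPerDir 0 : ℕ) : ℤ) n).K = 0 ∧
        (mem (((PV d ℓ m K hd hL).sitesPerDir 0 : ℕ) : ℤ) n).k = n + 1 ∧
        (mem (((PV d ℓ m K hd hL).sitesPerDir 0 : ℕ) : ℤ) n).cf = (((ℓ + 1 : ℕ) : ℝ)) ^ (mem (((PV d ℓ m K hd hL).sitesPerDir 0 : ℕ) : ℤ) n).k ∧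
        (∀ x, (mem (((PV d ℓ m K hd hL).sitesPerDir 0 : ℕ) : ℤ) n).D.lev x = n) ∧
        ML ≤ (geo9K (mem (((PV d ℓ m K hd hL).sitesPerDir 0 : ℕ) : ℤ) n)).M ∧
        ∀ t, β (mem (((PV d ℓ m K hd hL).sitesPerDir 0 : ℕ) : ℤ) n).hN (mem (((PV d ℓ m K hd hL).sitesPerDir 0 : ℕ) : ℤ) n).D
          (mem (((PV d ℓ m K hd hL).sitesPerDir 0 : ℕ) : ℤ) n).hk (ιBm (((PV d ℓ m K hd hL).sitesPerDir 0 : ℕ) : ℤ) n t) = t := by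
  classical
  obtain ⟨a, h8, hMa, -⟩ := exists_exponent ℓ (by omega) ML 0 1 le_rfl
  -- for every `(P, n)`: a member with `β` onto, which is the prescribed one whenever `P = 2L^T` with `n + (a+3) ≤ T`
  have hall : ∀ (P : ℤ) (n : ℕ), ∃ i : KIdx d ℓ hd hL b₀ b₁, Function.Surjective (β i.hN i.D i.hk) ∧
      ∀ T : ℕ, P = ((2 * (ℓ + 1) ^ T : ℕ) : ℤ) → 1 ≤ n → n + (a + 3) ≤ T →
        i.m = T ∧ i.K = 0 ∧ i.k = n + 1 ∧ i.Mh = (ℓ + 1) ^ a ∧ i.cf = (((ℓ + 1 : ℕ) : ℝ)) ^ i.k ∧ ∀ x, i.D.lev x = n := by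
    intro P n
    by_cases h : ∃ T : ℕ, P = ((2 * (ℓ + 1) ^ T : ℕ) : ℤ) ∧ 1 ≤ n ∧ n + (a + 3) ≤ T
    · obtain ⟨T, hP, hn, hT⟩ := h
      obtain ⟨i, him, hiK, hik, hiMh, hicf, hiD, hsurj⟩ :=
        exists_constLev_member (d := d) (hd := hd) (hL := hL) hℓ hb₀ hb₁ (T := T) (s := T - (n + a + 2)) hn h8 (by omega) (by omega)
      refine ⟨i, hsurj, fun T' hP' _ _ => ?_⟩
      have hTT' : T = T' := exponent_eq_of_period_eq (by omega) (hP.symm.trans hP')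
      subst hTT'
      exact ⟨him, hiK, hik, hiMh, hicf, hiD⟩
    · -- a default member (level 1, `a = 2`, `s = 1`) with `β` onto; the spec premise is then contradictory
      have h8' : 8 ≤ (ℓ + 1) ^ 2 := by nlinarith
      obtain ⟨i, -, -, -, -, -, -, hsurj⟩ :=
        exists_constLev_member (d := d) (hd := hd) (hL := hL) hℓ hb₀ hb₁ (T := 6) (n := 1) (a := 2) (s := 1) le_rfl h8' le_rfl rfl
      exact ⟨i, hsurj, fun T hP hn hT => (h ⟨T, hP, hn, hT⟩).elim⟩
  choose mem hsurj hspec using hall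
  refine ⟨a + 3, mem, fun P n => Function.surjInv (hsurj P n), fun m K n hn hT => ?_⟩
  obtain ⟨him, hiK, hik, hiMh, hicf, hiD⟩ := hspec _ n (m + K) (period_eq m K) hn hT
  refine ⟨him, hiK, hik, hicf, hiD, ?_, fun t => Function.surjInv_eq (hsurj _ n) t⟩
  -- `M = L·M_h = L^{a+1} ≥ M_L`
  show ML ≤ ((ℓ + 1 : ℕ) : ℝ) * ((mem _ n).Mh : ℝ)
  rw [hiMh]
  have hc : ((ℓ + 1 : ℕ) : ℝ) = (ℓ : ℝ) + 1 := by push_cast; ring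
  rw [hc]
  exact hMa

end Catalogue

/-! ## §3 ★★★★★★★ The endpoint with the catalogue discharged -/

section Endpoint

variable {N : ℕ} [NeZero N]
variable [instF : ∀ i : KIdx d ℓ hd hL b₀ b₁, Fintype (geo9K i).Site] [∀ i : KIdx d ℓ hd hL b₀ b₁, DecidableEq (geo9K i).Site]

/-- ★★★★★★★ **[B8] THM 2 AT THE `SU(N)`-VALUED SETUP-TORUS OBJECTS OF EVERY `PV d ℓ m K` WITH `k + k₀ ≤ m + K`, FROM THE ANALYTIC CUBE DATA AND THE (B)-LINES
ALONE — the member catalogue CONSTRUCTED** (`1 ≤ N ≤ 25`, `d + 1 ≥ 2`, odd `L = ℓ + 1 ≥ 5`, band `0 < b₀ ≤ b₁`; (B)-line constants `B₀ ≥ 2∕(5(d+1)L)`,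
`c_B9 > 0`; threshold `c_L > 0` with `c_L·L² < α₀′`; cube scalars `p.Valid`, `KnitCubeGeoValid … p dρ`): THERE EXIST `k₀`, a catalogue `mem P n` with sections
`ιBm P n` (spec as in `exists_catalogue`, at file A10's geometry threshold), and `B₁, B₂, c₁ > 0` such that for EVERY `m K k η` with `1 ≤ k`, `k + k₀ ≤ m + K`,
`η > 0` (`P₀ = 2L^{m+K}`): analytic cube data `KnitCubeAnalytic (mem P₀ n) (bgY … U₀) b (ιBm P₀ n) Rr Hp p η_S⁻⁴` at every `n ≤ k` and every `SU(N)`-valued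
`P₀`-periodic `U₀ ∈ 𝔄_n(T_η, α₀)`, `α₀ ≤ c_L` → (B)-lines `B9P3PerAt` → `Thm2SetupSUAt (PV d ℓ m K hd hL) N k η 0 B₁ B₂ c₁ len (fun _ => True)`.  LOCATED
VOLUME THRESHOLD `k + k₀ ≤ m + K`; the two arrows' antecedents are displayed (M5.1–M5.8's output shapes), inhabited by nothing here; no estimate of [B8]∕[B9]
proved in files A1–A11; `stub_PV3A` NOT discharged; the Yang–Mills mass gap is NOT proved.
[cite: Balaban1985RegularSpaces, Thm 2 p.83 («there exists B₁»), (1.33)–(1.39) pp.82–83, p.77 («Ω_j = T_η»), p.76; Balaban1984PropagatorsII, (2.1)–(2.4) p.224, Lemma 2.1 p.234; Balaban1985BackgroundPropagators, Thm 3.1 p.397 («for M ≥ M₁»), Thm 3.7 pp.409–410, Thm 3.9 p.413, Thm 3.2 (3.48) p.398; Balaban1985Averaging, (4) p.18, Prop. 2 p.26] -/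
theorem thm2SetupSUAt_catalogued_exists (hN : N ≤ 25) (hd2 : 2 ≤ d + 1) (hℓ : 4 ≤ ℓ) (hb₀ : 0 < b₀) (hb₁ : b₀ ≤ b₁)
    {B₀ B₀β cB9 βH cL : ℝ} {len : LSite (d + 1) → ℝ}
    (hB₀ : 0 < B₀) (hB : 2 ≤ 5 * ((d + 1 : ℕ) : ℝ) * ((ℓ + 1 : ℕ) : ℝ) * B₀) (hcB9 : 0 < cB9) (hcL : 0 < cL)
    {ι : Type} [Fintype ι] [DecidableEq ι] {b : Module.Basis ι ℝ (Matrix (Fin N) (Fin N) ℂ)} {M₂ : ℝ}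
    (p : KnitCubeParams) (hp : p.Valid d ℓ b M₂) {dρ : ℕ} (hg : KnitCubeGeoValid d ℓ hd hL b₀ b₁ p dρ)
    (hαe : cL * (((ℓ + 1 : ℕ) : ℝ)) ^ (2 * 1) < p.α₀') (Rr : ℝ) (Hp : Prop) :
    letI : CStarAlgebra (Matrix (Fin N) (Fin N) ℂ) := {}
    ∃ (k₀ : ℕ) (mem : ℤ → ℕ → KIdx d ℓ hd hL b₀ b₁) (ιBm : ∀ P n, BlkY (mem P n) → IBondY (mem P n)) (B₁ B₂ c₁ : ℝ),
      0 < B₁ ∧ 0 < B₂ ∧ 0 < c₁ ∧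
      (∀ (m K n : ℕ), 1 ≤ n → n + k₀ ≤ m + K →
        (mem (((PV d ℓ m K hd hL).sitesPerDir 0 : ℕ) : ℤ) n).m = m + K ∧ (mem (((PV d ℓ m K hd hL).sitesPerDir 0 : ℕ) : ℤ) n).K = 0 ∧
        (mem (((PV d ℓ m K hd hL).sitesPerDir 0 : ℕ) : ℤ) n).k = n + 1 ∧
        (mem (((PV d ℓ m K hd hL).sitesPerDir 0 : ℕ) : ℤ) n).cf = (((ℓ + 1 : ℕ) : ℝ)) ^ (mem (((PV d ℓ m K hd hL).sitesPerDir 0 : ℕ) : ℤ) n).k ∧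
        (∀ z : SiteY (mem (((PV d ℓ m K hd hL).sitesPerDir 0 : ℕ) : ℤ) n), levY (mem (((PV d ℓ m K hd hL).sitesPerDir 0 : ℕ) : ℤ) n) z = n) ∧
        ∀ t, β (mem (((PV d ℓ m K hd hL).sitesPerDir 0 : ℕ) : ℤ) n).hN (mem (((PV d ℓ m K hd hL).sitesPerDir 0 : ℕ) : ℤ) n).D
          (mem (((PV d ℓ m K hd hL).sitesPerDir 0 : ℕ) : ℤ) n).hk (ιBm (((PV d ℓ m K hd hL).sitesPerDir 0 : ℕ) : ℤ) n t) = t) ∧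
      ∀ (m K k : ℕ) (η : ℝ), 1 ≤ k → k + k₀ ≤ m + K → 0 < η →
        (∀ n, 1 ≤ n → n ≤ k → ∀ ⦃α₀ : ℝ⦄, 0 < α₀ → α₀ ≤ cL → ∀ U₀ : LSite (d + 1) → Fin (d + 1) → (Matrix (Fin N) (Fin N) ℂ)ˣ,
            (∀ x κ, U₀ x κ ∈ specialUnitaryUnits (Fin N)) →
            (∀ (x : LSite (d + 1)) (μ : Fin (d + 1)), U₀ (x + (((PV d ℓ m K hd hL).sitesPerDir 0 : ℕ) : ℤ) • e μ) = U₀ x) →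
            InAk (ℓ + 1) n η α₀ (fun _ => (Set.univ : Set (LSite (d + 1)))) U₀ →
            Nonempty (KnitCubeAnalytic (mem (((PV d ℓ m K hd hL).sitesPerDir 0 : ℕ) : ℤ) n)
              (bgY (mem (((PV d ℓ m K hd hL).sitesPerDir 0 : ℕ) : ℤ) n) U₀) b (ιBm (((PV d ℓ m K hd hL).sitesPerDir 0 : ℕ) : ℤ) n) Rr Hp p
              ((etaS (mem (((PV d ℓ m K hd hL).sitesPerDir 0 : ℕ) : ℤ) n) ^ 2 * etaS (mem (((PV d ℓ m K hd hL).sitesPerDir 0 : ℕ) : ℤ) n) ^ 2)⁻¹))) →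
        (∀ m', m' ≤ k → ∀ ⦃α₀ : ℝ⦄, 0 < α₀ → α₀ ≤ cL → ∀ U₀ : LSite (d + 1) → Fin (d + 1) → (Matrix (Fin N) (Fin N) ℂ)ˣ,
            (∀ x κ, U₀ x κ ∈ specialUnitaryUnits (Fin N)) →
            (∀ (x : LSite (d + 1)) (μ : Fin (d + 1)), U₀ (x + (((PV d ℓ m K hd hL).sitesPerDir 0 : ℕ) : ℤ) • e μ) = U₀ x) →
            InAk (ℓ + 1) m' η α₀ (fun _ => (Set.univ : Set (LSite (d + 1)))) U₀ →
            B9P3PerAt (𝔸 := Matrix (Fin N) (Fin N) ℂ) (ℓ + 1) B₀ B₀β cB9 βH len η m' α₀ (((PV d ℓ m K hd hL).sitesPerDir 0 : ℕ) : ℤ) U₀) →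
        Thm2SetupSUAt (PV d ℓ m K hd hL) N k η 0 B₁ B₂ c₁ len (fun _ => True) := by
  letI : CStarAlgebra (Matrix (Fin N) (Fin N) ℂ) := {}
  -- the geometry threshold of file A10, then the catalogue above it
  obtain ⟨ML, hgeo⟩ := exists_threshold_knitCubeGeometry (d := d) (ℓ := ℓ) (hd := hd) (hL := hL) (b₀ := b₀) (b₁ := b₁) Rr Hp hg
  obtain ⟨k₀, mem, ιBm, hcat⟩ := exists_catalogue (d := d) (hd := hd) (hL := hL) hℓ hb₀ hb₁ ML
  -- file A9's endpoint at the catalogue (level slack `e_s = 1`)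
  obtain ⟨B₁, B₂, c₁, hB₁, hB₂, hc₁, H⟩ :=
    thm2SetupSUAt_ofCubes_exists (len := len) (B₀β := B₀β) (β := βH) (c := B6.c1 dρ p.ρf 1) hN hd2 hB₀ hB hcB9 hcL p hp 1 hαe
      (fun _ P n => mem P n) (fun _ P n => ιBm P n) Rr Hp (fun _ P n => (etaS (mem P n) ^ 2 * etaS (mem P n) ^ 2)⁻¹)
  refine ⟨k₀, mem, ιBm, B₁, B₂, c₁, hB₁, hB₂, hc₁, fun m K n hn hT => ?_, fun m K k η hk hkT hη han hb9 => ?_⟩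
  · obtain ⟨him, hiK, hik, hicf, hiD, -, hι⟩ := hcat m K n hn hT
    exact ⟨him, hiK, hik, hicf, fun z => hiD z.1, hι⟩
  · refine H m K k η hk (by omega) hη (fun n hn hnk => ?_) (fun n hn hnk z => ?_) (fun n hn hnk => ?_) (fun n hn hnk α₀ hα hαc U₀ hU₀G hU₀per hA => ?_) hb9
    · -- the member lives on the torus of period `P₀`
      obtain ⟨him, hiK, -, -, -, -, -⟩ := hcat m K n hn (by omega)
      rw [him, hiK, period_eq, period_eq]
      simp
    · obtain ⟨-, -, -, -, hiD, -, -⟩ := hcat m K n hn (by omega)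
      exact hiD z.1
    · obtain ⟨-, -, hik, -, -, -, -⟩ := hcat m K n hn (by omega)
      omega
    · obtain ⟨-, -, -, -, -, hM, -⟩ := hcat m K n hn (by omega)
      obtain ⟨an⟩ := han n hn hnk hα hαc U₀ hU₀G hU₀per hA
      exact ⟨KnitCubeInputs.ofGeometry (hgeo _ hM) an⟩

end Endpoint

end Literature.MathematicalPhysics.QuantumFieldTheory.Balaban1983to89.B8Thm2TorusMemberCatalogue

end
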